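import Mathlib.Analysis.Calculus.LocalExtr.Basic
import Mathlib.Analysis.Calculus.MeanValue
import Mathlib.Topology.Order.IntermediateValue
import Literature.Geometry.Lorentzian.KerrRegionIINullRayCore

/-!
# The radial motion of a zero-energy null geodesic of Kerr: the real-variable core
# (helper file for `KerrZeroEnergyUntrappedKS`, stmt-FinalStateConjecture-13857, route ZeroEnergyKerrOrBomb)

Along a zero-energy (`E = 0`) null geodesic of sub-extremal Kerr in `{r > r₊}` the radius `r(t)` is
twice differentiable, `ṙ = ρ`, `ρ̇ = H` (the coordinate Hessian of `r` on the velocity), and Carter's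
first integrals give the radial equation `Σ² ρ² = R(r)`, `R(r) = a²L² − Δ(r)𝒦`,
`Δ(r) = r² − 2Mr + a²`, with `𝒦 ≥ L² > 0` (O'Neill 1995, Ch. 4, Thm. 4.2.2; Carter 1968, §IV), while
the radial-acceleration identity gives `2Σ² H = −2(r − M)𝒦 < 0` at every turning point `ρ = 0`.
This file proves that NO family of real functions `(r, ρ, H, Σ)` on the whole line can satisfy these
relations with `r` confined to a shell `[r₁, r₂]`, `r₁ > M` (`KerrUntrapped.radial_core`): `R` is
strictly decreasing on `[r₁, ∞)`, so `r` has at most one turning point (a strict maximum), is monotone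
on a half-line with `|ρ|` bounded below there, and leaves the shell in finite parameter time
(`Kerr.not_forall_gt_of_deriv_le_neg`). The geometric inputs are supplied in the closing file.

## References

* B. O'Neill, *The geometry of Kerr black holes*, A K Peters 1995, Ch. 4, §4.2 (Thm. 4.2.2) and
  §4.14 (the `r`-motion of null geodesics).
* B. Carter, Phys. Rev. 174 (1968) 1559–1571, §IV.
-/

noncomputable section

set_option linter.dupNamespace false

namespace Summit.FinalStateConjecture.FinalStateConjecture.Theorems

open Set Filter Topology Literature.Geometry.Lorentzian

namespace KerrUntrapped

/-! ### Local sign of a function at a simple zero -/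

/-- A function vanishing at `t₀` with negative derivative there is negative just to the right of
`t₀`. -/
theorem exists_neg_right_of_hasDerivAt {ρ : ℝ → ℝ} {t₀ D : ℝ} (h : HasDerivAt ρ D t₀) (h0 : ρ t₀ = 0)
    (hD : D < 0) : ∃ δ > 0, ∀ t, t₀ < t → t < t₀ + δ → ρ t < 0 := by
  have ho := (hasDerivAt_iff_isLittleO.1 h).def (show (0 : ℝ) < -D / 2 by linarith)
  obtain ⟨δ, hδ, hball⟩ := Metric.eventually_nhds_iff.1 ho
  refine ⟨δ, hδ, fun t ht₁ ht₂ ↦ ?_⟩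
  have hdist : dist t t₀ < δ := by
    rw [Real.dist_eq, abs_of_pos (by linarith)]; linarith
  have hb := hball hdist
  rw [h0, sub_zero, smul_eq_mul, Real.norm_eq_abs, Real.norm_eq_abs,
    abs_of_pos (sub_pos.2 ht₁)] at hb
  have h1 := (abs_le.1 hb).2
  nlinarith [sub_pos.2 ht₁]

/-! ### Forward and backward escape from the shell -/

/-- **Forward escape.** Let `f` have derivative `ρ` on `ℝ`, stay above `r₁ > M`, and satisfy
`Σ² ρ² = A − Δ(f) K` (`Δ(x) = x² − 2Mx + b`) with `K ≥ 0`, `0 < Σ ≤ Σmax`. If `ρ < 0` on a half-line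
`[T₀, ∞)` a contradiction follows: `f` is non-increasing there, so
`A − Δ(f)K ≥ A − Δ(f T₀)K = Σ²ρ(T₀)² > 0` (`Δ` is increasing beyond `M`), whence `ρ ≤ −κ < 0` on the
half-line and `f` would leave `{f > r₁ − 1}` (`Kerr.not_forall_gt_of_deriv_le_neg`). -/
theorem radial_forward_escape {f ρ Sg : ℝ → ℝ} {r₁ M A K b Smax T₀ : ℝ} (hM : M < r₁) (hK : 0 ≤ K)
    (hSmax : 0 < Smax) (hf : ∀ t, HasDerivAt f (ρ t) t) (hlo : ∀ t, r₁ ≤ f t)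
    (hrad : ∀ t, Sg t ^ 2 * ρ t ^ 2 = A - (f t ^ 2 - 2 * M * f t + b) * K)
    (hSpos : ∀ t, 0 < Sg t) (hSle : ∀ t, Sg t ≤ Smax) (hneg : ∀ t, T₀ ≤ t → ρ t < 0) : False := by
  -- `f` is non-increasing on `[T₀, ∞)`
  have hanti : ∀ t, T₀ ≤ t → f t ≤ f T₀ := by
    intro t ht
    have hmono : AntitoneOn f (Ici T₀) :=
      antitoneOn_of_deriv_nonpos (convex_Ici T₀)
        (fun s _ ↦ (hf s).continuousAt.continuousWithinAt)
        (fun s _ ↦ (hf s).differentiableAt.differentiableWithinAt)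
        (fun s hs ↦ by
          rw [interior_Ici] at hs
          rw [(hf s).deriv]
          exact (hneg s (le_of_lt hs)).le)
    exact hmono self_mem_Ici (mem_Ici.2 ht) ht
  -- the level `c = A − Δ(f T₀) K = Σ(T₀)² ρ(T₀)² > 0`
  have hρ0 : ρ T₀ ≠ 0 := (hneg T₀ le_rfl).ne
  set c : ℝ := A - (f T₀ ^ 2 - 2 * M * f T₀ + b) * K with hc_def
  have hc : 0 < c := by
    rw [hc_def, ← hrad T₀]
    exact mul_pos (pow_pos (hSpos T₀) 2) (lt_of_le_of_ne (sq_nonneg _) (Ne.symm (pow_ne_zero 2 hρ0)))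
  -- below the level `f T₀` the potential is at least `c`
  have hlow : ∀ t, T₀ ≤ t → c ≤ Sg t ^ 2 * ρ t ^ 2 := by
    intro t ht
    rw [hrad t, hc_def]
    have h1 : f t ≤ f T₀ := hanti t ht
    have h2 : f t ^ 2 - 2 * M * f t + b ≤ f T₀ ^ 2 - 2 * M * f T₀ + b := by
      nlinarith [hlo t, hlo T₀]
    nlinarith [mul_le_mul_of_nonneg_right h2 hK]
  -- hence `ρ ≤ −κ`
  set κ : ℝ := Real.sqrt c / Smax with hκ_def
  have hκ : 0 < κ := div_pos (Real.sqrt_pos.2 hc) hSmax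
  have hκ2 : κ ^ 2 * Smax ^ 2 = c := by
    rw [hκ_def, div_pow, Real.sq_sqrt hc.le]
    field_simp
  have hρle : ∀ t, T₀ ≤ t → ρ t ≤ -κ := by
    intro t ht
    have h1 := hlow t ht
    have hS2 : Sg t ^ 2 ≤ Smax ^ 2 := pow_le_pow_left₀ (hSpos t).le (hSle t) 2
    have h2 := mul_le_mul_of_nonneg_right hS2 (sq_nonneg (ρ t))
    have h3 : κ ^ 2 ≤ ρ t ^ 2 := by
      have hSmax2 : 0 < Smax ^ 2 := by positivity
      nlinarith
    have hρneg := hneg t ht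
    nlinarith
  exact Kerr.not_forall_gt_of_deriv_le_neg hκ (fun t _ ↦ hf t) hρle
    (fun t _ ↦ show r₁ - 1 < f t by linarith [hlo t])

/-- **Backward escape**: the time reversal of `radial_forward_escape` — if `ρ > 0` on a half-line
`(−∞, T₀]`, a contradiction follows (apply the forward statement to `s ↦ f (−s)`). -/
theorem radial_backward_escape {f ρ Sg : ℝ → ℝ} {r₁ M A K b Smax T₀ : ℝ} (hM : M < r₁) (hK : 0 ≤ K)
    (hSmax : 0 < Smax) (hf : ∀ t, HasDerivAt f (ρ t) t) (hlo : ∀ t, r₁ ≤ f t)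
    (hrad : ∀ t, Sg t ^ 2 * ρ t ^ 2 = A - (f t ^ 2 - 2 * M * f t + b) * K)
    (hSpos : ∀ t, 0 < Sg t) (hSle : ∀ t, Sg t ≤ Smax) (hpos : ∀ t, t ≤ T₀ → 0 < ρ t) : False := by
  refine radial_forward_escape (f := fun s ↦ f (-s)) (ρ := fun s ↦ -ρ (-s)) (Sg := fun s ↦ Sg (-s))
    (T₀ := -T₀) (A := A) (b := b) hM hK hSmax (fun s ↦ ?_) (fun s ↦ hlo (-s)) (fun s ↦ ?_)
    (fun s ↦ hSpos (-s)) (fun s ↦ hSle (-s)) (fun s hs ↦ ?_)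
  · exact ((hf (-s)).scomp s (hasDerivAt_neg s)).congr_deriv (by simp)
  · rw [neg_sq]; exact hrad (-s)
  · have := hpos (-s) (by linarith)
    linarith

/-! ### The core: no confined zero-energy radial motion -/

/-- **No zero-energy radial motion is confined to a shell beyond `r = M`.** There are no real
functions `f, ρ, H, Σ` on `ℝ` with `f' = ρ`, `ρ' = H`, `f ≥ r₁ > M`, `Σ² ρ² = A − Δ(f) K`
(`Δ(x) = x² − 2Mx + b`, `K > 0`), `H < 0` wherever `ρ = 0`, and `0 < Σ ≤ Σmax`. Indeed
`R = A − ΔK` is strictly decreasing on `[r₁, ∞)` and `R(f) ≥ 0`, so at a zero `t₀` of `ρ` (where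
`R(f t₀) = 0`) `f` attains its global maximum; `ρ < 0` just after `t₀` (`H(t₀) < 0`), a later zero
of `ρ` would produce an interior minimum of `f` on the segment between them, again a zero of `ρ`,
at which `f` would have to equal its maximum — absurd; so `ρ < 0` on `(t₀, ∞)` and
`radial_forward_escape` applies. With no zero at all, `ρ` has constant sign and one of the two escape
lemmas applies. This is the `r`-motion analysis of O'Neill 1995, Ch. 4 (Thm. 4.2.2 with the
first-integral and turning-point equations) for `E = 0`, where `R′ = −Δ′𝒦 < 0` on `r > M`. -/
theorem radial_core {f ρ H Sg : ℝ → ℝ} {r₁ M A K b Smax : ℝ} (hM : M < r₁) (hK : 0 < K)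
    (hSmax : 0 < Smax) (hf : ∀ t, HasDerivAt f (ρ t) t) (hρ : ∀ t, HasDerivAt ρ (H t) t)
    (hlo : ∀ t, r₁ ≤ f t)
    (hrad : ∀ t, Sg t ^ 2 * ρ t ^ 2 = A - (f t ^ 2 - 2 * M * f t + b) * K)
    (hturn : ∀ t, ρ t = 0 → H t < 0) (hSpos : ∀ t, 0 < Sg t) (hSle : ∀ t, Sg t ≤ Smax) :
    False := by
  have hfc : Continuous f := continuous_iff_continuousAt.2 fun t ↦ (hf t).continuousAt
  have hρc : Continuous ρ := continuous_iff_continuousAt.2 fun t ↦ (hρ t).continuousAt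
  -- the radial potential and its strict monotonicity beyond `M`
  set R : ℝ → ℝ := fun x ↦ A - (x ^ 2 - 2 * M * x + b) * K with hR
  have hRf : ∀ t, R (f t) = Sg t ^ 2 * ρ t ^ 2 := fun t ↦ (hrad t).symm
  have hRstrict : ∀ x y, r₁ ≤ x → x < y → R y < R x := by
    intro x y hx hxy
    simp only [hR]
    nlinarith [mul_pos (sub_pos.2 hxy) hK]
  have hRnonneg : ∀ t, 0 ≤ R (f t) := fun t ↦ by rw [hRf]; positivity
  -- at a zero of `ρ` the radius is maximal
  have hmax_of_zero : ∀ t, ρ t = 0 → ∀ s, f s ≤ f t := by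
    intro t ht s
    by_contra hlt
    push Not at hlt
    have h1 : R (f s) < R (f t) := hRstrict _ _ (hlo t) hlt
    have h2 : R (f t) = 0 := by rw [hRf, ht]; ring
    linarith [hRnonneg s]
  have heq_of_zero : ∀ t t', ρ t = 0 → ρ t' = 0 → f t = f t' := fun t t' ht ht' ↦
    le_antisymm (hmax_of_zero t' ht' t) (hmax_of_zero t ht t')
  -- zeros of `ρ` between parameters of opposite sign
  have hzero_between : ∀ t₁ t₂, t₁ ≤ t₂ → ρ t₁ ≤ 0 → 0 ≤ ρ t₂ → ∃ t ∈ Icc t₁ t₂, ρ t = 0 :=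
    fun t₁ t₂ h12 h1 h2 ↦ intermediate_value_Icc h12 hρc.continuousOn ⟨h1, h2⟩
  have hzero_between' : ∀ t₁ t₂, t₁ ≤ t₂ → 0 ≤ ρ t₁ → ρ t₂ ≤ 0 → ∃ t ∈ Icc t₁ t₂, ρ t = 0 :=
    fun t₁ t₂ h12 h1 h2 ↦ intermediate_value_Icc' h12 hρc.continuousOn ⟨h2, h1⟩
  by_cases hZ : ∃ t₀, ρ t₀ = 0
  · obtain ⟨t₀, ht₀⟩ := hZ
    obtain ⟨δ, hδ, hδneg⟩ := exists_neg_right_of_hasDerivAt (hρ t₀) ht₀ (hturn t₀ ht₀)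
    -- `f` drops strictly just after `t₀`
    have hdrop : ∀ s, t₀ < s → s < t₀ + δ → f s < f t₀ := by
      intro s hs hsδ
      obtain ⟨ξ, hξ, hξeq⟩ :=
        exists_hasDerivAt_eq_slope f ρ hs hfc.continuousOn (fun x _ ↦ hf x)
      have hρξ : ρ ξ < 0 := hδneg ξ hξ.1 (hξ.2.trans hsδ)
      have hps : 0 < s - t₀ := sub_pos.2 hs
      have hfs : f s - f t₀ = ρ ξ * (s - t₀) := by
        rw [hξeq]; field_simp
      nlinarith [mul_neg_of_neg_of_pos hρξ hps]
    set t₁ : ℝ := t₀ + δ / 2 with ht₁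
    have ht₀₁ : t₀ < t₁ := by rw [ht₁]; linarith
    have hρt₁ : ρ t₁ < 0 := hδneg t₁ ht₀₁ (by rw [ht₁]; linarith)
    -- no later zero of `ρ`
    have hnozero : ∀ t, t₀ < t → ρ t ≠ 0 := by
      intro t₂ ht₂ hρt₂
      have hf2 : f t₂ = f t₀ := heq_of_zero _ _ hρt₂ ht₀
      set s : ℝ := min t₁ ((t₀ + t₂) / 2) with hs
      have hs₀ : t₀ < s := lt_min ht₀₁ (by linarith)
      have hs₂ : s < t₂ := (min_le_right _ _).trans_lt (by linarith)
      have hsδ : s < t₀ + δ := (min_le_left _ _).trans_lt (by rw [ht₁]; linarith)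
      have hfs : f s < f t₀ := hdrop s hs₀ hsδ
      obtain ⟨t₃, ht₃, hmin⟩ :=
        isCompact_Icc.exists_isMinOn (nonempty_Icc.2 ht₂.le) hfc.continuousOn
      have h3s : f t₃ ≤ f s := hmin ⟨hs₀.le, hs₂.le⟩
      have ht₃₀ : t₃ ≠ t₀ := fun h ↦ by rw [h] at h3s; linarith
      have ht₃₂ : t₃ ≠ t₂ := fun h ↦ by rw [h, hf2] at h3s; linarith
      have ht₃' : t₃ ∈ Ioo t₀ t₂ :=
        ⟨lt_of_le_of_ne ht₃.1 (Ne.symm ht₃₀), lt_of_le_of_ne ht₃.2 ht₃₂⟩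
      have hloc : IsLocalMin f t₃ := hmin.isLocalMin (Icc_mem_nhds ht₃'.1 ht₃'.2)
      have hρ3 : ρ t₃ = 0 := hloc.hasDerivAt_eq_zero (hf t₃)
      have h33 := heq_of_zero _ _ hρ3 ht₀
      linarith
    -- hence `ρ < 0` on `(t₀, ∞)`
    have hnegall : ∀ t, t₀ < t → ρ t < 0 := by
      intro t ht
      by_contra hge
      push Not at hge
      rcases le_total t₁ t with h | h
      · obtain ⟨z, hz, hz0⟩ := hzero_between t₁ t h hρt₁.le hge
        exact hnozero z (ht₀₁.trans_le hz.1) hz0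
      · obtain ⟨z, hz, hz0⟩ := hzero_between' t t₁ h hge hρt₁.le
        exact hnozero z (ht.trans_le hz.1) hz0
    exact radial_forward_escape (T₀ := t₁) hM hK.le hSmax hf hlo hrad hSpos hSle
      (fun t ht ↦ hnegall t (ht₀₁.trans_le ht))
  · push Not at hZ
    rcases lt_or_gt_of_ne (hZ 0) with h0 | h0
    · refine radial_forward_escape (T₀ := 0) hM hK.le hSmax hf hlo hrad hSpos hSle fun t ht ↦ ?_
      by_contra hge
      push Not at hge
      obtain ⟨z, -, hz0⟩ := hzero_between 0 t ht h0.le hge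
      exact hZ z hz0
    · refine radial_backward_escape (T₀ := 0) hM hK.le hSmax hf hlo hrad hSpos hSle fun t ht ↦ ?_
      by_contra hle
      push Not at hle
      obtain ⟨z, -, hz0⟩ := hzero_between t 0 ht hle h0.le
      exact hZ z hz0

end KerrUntrapped

end Summit.FinalStateConjecture.FinalStateConjecture.Theorems

end
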